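import Summits.QuantumFields.YangMills.Theorems.VirialFluxGapRingFrameSecondDerivativeBound
import Summits.QuantumFields.YangMills.Theorems.VirialFluxGapGradientEnergyBound
import HarnessLib

/-!
# Route `VirialFluxGap` (YangMills): the `L`-EXPLICIT gradient–energy bound `(∂_Y F₀)² ≤ 2·C·L⁴·b²·F₀`

Corollary for the central charts ∕ assembly of ⟨stmt-QuantumFields-24141⟩: ✓`frameD_sq_le_two_mul_ringDeficit` (non-negativity + Taylor) with
✓`exists_bound_frameD2_ringPoly` (absolute second-derivative constant, `≤ 27L⁴` terms):

  ★★★ `exists_frameD_sq_le_L4_ringDeficit` : `∃ C ≥ 0` absolute, `∀ L Q Y b`, `Y` skew-Hermitian traceless with `‖Y_w‖ ≤ b`: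
  `(frameD Y ringPoly (ringCoord Q))² ≤ 2·(C·L⁴·b²)·F₀(Q)`.

At the projected point of the central chart (`F₀(π_C P) ≤ 36L²ρ²`, ✓`ringDeficit_centralProj_le`) this bounds every frame component of
`∇F₀∘π_C` by `O(L³ρ)` without the explicit seam vertex.  HONEST FRAMING: calculus; ⟨24141⟩ stays OPEN; the Yang–Mills mass gap is NOT proved; no
summit is proved by a line.  THEOREMS ONLY, standard axioms.  Width seat `ym-line-sfw-p2-w3` g58, `--supports stmt-QuantumFields-24141`.
References: [folklore].
-/

set_option autoImplicit false

noncomputable section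

open scoped Matrix BigOperators
open Literature.MathematicalPhysics.QuantumFieldTheory hiding SU2
open Literature.MathematicalPhysics.QuantumLattice

namespace Summit.QuantumFields.YangMills.Theorems.VirialFluxGap.FrameHessian

open Summit.QuantumFields.YangMills.Theorems.FemtoTransferGap
open Summit.QuantumFields.YangMills.Theorems.VirialFluxGap.RingDeficit
open Summit.QuantumFields.YangMills.Theorems.VirialFluxGap.FrameDerivative

open scoped Matrix.Norms.Frobenius

/-- ★★★ **`L`-uniform control of the frame gradient by the energy**: an absolute `C ≥ 0` with
`(∂_Y F₀(Q))² ≤ 2·(C·L⁴·b²)·F₀(Q)` for every `L`, every ring history `Q` and every skew-Hermitian traceless assignment `Y` with `‖Y_w‖ ≤ b`.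
[folklore] -/
theorem exists_frameD_sq_le_L4_ringDeficit :
    ∃ C : ℝ, 0 ≤ C ∧ ∀ (L : ℕ) [NeZero L] (Q : ((Fin (2 * L - 1 + 1) → GaugeConfig 3 L SU2) × (Site 3 L → SU2)))
      (Y : ((Fin (2 * L - 1 + 1) × Edge 3 L) ⊕ Site 3 L) → Matrix (Fin 2) (Fin 2) ℂ) (hY : ∀ w, (Y w)ᴴ = -Y w) (hY0 : ∀ w, (Y w).trace = 0)
      (b : ℝ), 0 ≤ b → (∀ w, ‖Y w‖ ≤ b) →
      (frameD Y (ringPoly L) (ringCoord L Q)) ^ 2 ≤ 2 * (C * (L : ℝ) ^ 4 * b ^ 2) * ringDeficit L (fun _ => false) Q := by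
  obtain ⟨C, hC0, hC⟩ := exists_bound_frameD2_ringPoly
  refine ⟨C, hC0, ?_⟩
  intro L _ Q Y hY hY0 b hb hYb
  have hM : ∀ Q' : (Fin (2 * L - 1 + 1) → GaugeConfig 3 L SU2) × (Site 3 L → SU2),
      |frameD Y (frameD Y (ringPoly L)) (ringCoord L Q')| ≤ C * (L : ℝ) ^ 4 * b ^ 2 := fun Q' => by
    have h := hC L Q' Y Y b b hb hb hYb hYb
    calc _ ≤ C * (L : ℝ) ^ 4 * b * b := h
      _ = C * (L : ℝ) ^ 4 * b ^ 2 := by ring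
  exact frameD_sq_le_two_mul_ringDeficit Y hY hY0 hM Q

end Summit.QuantumFields.YangMills.Theorems.VirialFluxGap.FrameHessian

end
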